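/-
Copyright (c) 2026 the pub-hodgecm-mathlib formalisation cell (harness21).  Prover seat hodgecm-mathlib-LH4-p19 (g3), req620 Track A «(D-RAM) FOUR-FRAME» squad
(STAGE-1b, row (2) of the piece `f_{T₊}`, the (β₂) road (R-36) «PURE-CELL LEDGER»; β₂ WORD #29∕#31 «p19: RAY BANDS» — the per-vertex reads of an upper-line RAY cell:
exact level = the sphere digit, label = the sphere sign), 2026-09-05.
-/
import Summits.HodgeConjecture.HodgeConjecture.Theorems.F0P3cDyRamUpperLineRayLetters        -- ★ p864080 (LH4-p12 (g9)): `exactLevel_iff_v_rayScalar_eq`, `latticeInLevel_iff_v_rayScalar_le`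
import Summits.HodgeConjecture.HodgeConjecture.Theorems.F0P3cDyRamUpperLineCellCentre        -- this seat (F3): `trace_div_cellScalar_eq_root`; brings ★ p863048 `…RayScalarNearlyFixed`
import Summits.HodgeConjecture.HodgeConjecture.Theorems.F0P3cDyRamRootRegimeAffineLabel      -- this seat (F2): `normSign_eq_mul_of_rootRegime`, `v_mul_eq_of_v_sub_lt`, `v_centre_iff_of_lt`, `v_centre_le_iff_of_le`
import Summits.HodgeConjecture.HodgeConjecture.Theorems.F0P3cDyRamDiagonalCellLetter         -- ★ (this lineage): `inv_add_map_inv_eq_map_pairing` (the glue letter)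
import Summits.HodgeConjecture.HodgeConjecture.Theorems.F0P3cDyRamSmulXPlusLabel              -- ★ (LH4-p13): `labelPlus_smul_xPlus_iff_exists_norm`
import Literature.NumberTheory.LocalFields.ValuedCompleteIsAdicComplete                      -- ★ BRIDGE-AC: `isAdicComplete_valuedInteger_of_completeSpace`
import HarnessLib

/-!
# Crux `H413`, line LH4 «(D-RAM) FOUR-FRAME» — STAGE-1b, row (2), the (β₂) road (R-36), (OFF) residue, RAY bands: «THE PER-VERTEX READS OF AN UPPER-LINE RAY CELL» — for a
# glued vertex presented in ★ (C1)'s line model, the EXACT LEVEL `ℓ₀` is the SPHERE DIGIT `|γ₁(V − W₁)| = 1` (and the level `0` the ball `≤ 1`), and on that sphere the label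
# `VS_{m⋆}(Γ − 1 | L) = VS_{m⋆}(X₊)` is the SIGN `ω(pw·(ϖσϖ)^b)·ω(γ₁(V − W₁)) = 1`

Cell `hodgecm-mathlib` (D-0151), FLOOR 0, crux item H413 = `stmt-HodgeConjecture-24833`, route of record `HCCMUnconditional`; squad F0∕P3c∕LH4; lane
`--supports stmt-HodgeConjecture-24833 --as helper` (count-neutral; pays NO tier-0 row).  THEOREMS ONLY (no `def`, no instance, no notation, no `sorry`, default heartbeats);
★-only imports; states NO law; (β₂) stays a HYPOTHESIS.  Frame = ★ p863048's HEAD (HEAD B + ★ p861653's letters + sheet datum + line-model structure + population token + deep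
tokens) with `E` complete, plus the ROOT-REGIME tail: the glued vertex's coordinate `D₀⁻¹(jE pw)⁻¹ = κ₀ + jE(V)·ξ₀` (★ p862871), the cell's CENTRE `jE W·ξ₀ = κ_c − κ₀`
(`κ_c = ρμ∕(ρμ − μ)`, this seat's `…UpperLineCellCentre`), the slope element `jE B = (μ − ρμ)ξ₀`, and the two smallness letters of this seat's `…RootRegimeAffineLabel` for
`θ := B∕((ϖσϖ)^b·t₊)` (SLOPE `|θ − γ₁| ≤ |γ₁|·|ϖ|^{2d−1}`, ROOT `|γ₁(W − W₁)| ≤ |ϖ|^{2d−1}`, `γ₁, W₁` fixed).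

WHY (β₂ WORD #29 «p19: RAY BANDS»; this seat's RAYBANDS census A∕B).  The count socket ★ p864098 `cellDiff_eq_zero_of_fibration_reads₄` reads the two literals of an off-row
cell three-way through a digit predicate `NX` and a label `ψ`; after ★ p863487 (shell → exact level, both literals) the literal conjuncts of an upper-line cell are «exact level
`ℓ₀`» ∧ «`VS = VS(X₊)`» resp. ∧ «`¬ VS = VS(X₊)`».  THIS FILE turns both into digit statements about the vertex coordinate `V`:
* §1 `rayScalar_eq_root` — `e₀ = pw·B·(V − W)` on `E` (★ F3 `trace_div_cellScalar_eq_root` through `jE`), and `v_rayScalar_eq_iff_sphere` — `|e₀| = |ϖ|^{d%2} ↔ |γ₁(V − W₁)| = 1`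
  (`|pw·(ϖσϖ)^b| = 1`, `|t₊| = |ϖ|^{d%2}`, ★ F2 §1), `v_rayScalar_le_iff_ball` — `|e₀| ≤ 1 ↔ |γ₁(V − W₁)|·|t₊| ≤ 1`.
* §2 HEAD 1 `exactLevel_iff_sphere` — ★ p864080 `exactLevel_iff_v_rayScalar_eq` ∘ §1: `(InLevel ℓ₀ ∧ ¬ InLevel (ℓ₀+1)) ↔ |γ₁(V − W₁)| = 1` (the `NX` read), and
  `isOrd_div_iff_ball` — the DEPTH token `IsOrd cc (μ ∕ Y)` (★ p864080 `isOrd_div_pow_mul_iff` at `ℓ = 0`) `↔ |γ₁(V − W₁)|·|t₊| ≤ 1` (the depth digit).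
* §3 HEAD 2 `valueSet_eq_xPlus_iff_sphereSign` — ON the sphere: ★ p863048 gives the fixed-unit ray `e′` (`he₀v` ⟸ sphere), ★ `labelPlus_smul_xPlus_iff_exists_norm` its bit,
  ★ F2 `normSign_eq_mul_of_rootRegime` the dictionary: `VS_{m⋆}(Γ − 1 | L) = VS_{m⋆}(X₊) ↔ ω(pw·(ϖσϖ)^b)·ω(γ₁(V − W₁)) = 1` (the `ψ` read up to the population constant
  `ω(pw·(ϖσϖ)^b) = ω(−h_W)` of ★ p863859 HEAD 2).
WHAT IS NOT CLAIMED: the cell-level derivation of the SLOPE∕ROOT letters and of `|pw·(ϖσϖ)^b| = 1` (the assembler's, from ★ F3 §2 and the band), the population read, any count.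
HONEST LABEL.  Count-neutral valuation ∕ lattice algebra; nothing printed is asserted; no census law is stated; `hU_ray`, `hD_ray`, `hL_ray` stay OPEN; `HC_CM` is proved only modulo the
7 printed citations (2 remaining named inputs: hLiu418 = `stmt-HodgeConjecture-24832`, h413 = `stmt-HodgeConjecture-24833`) until rung 0 closes.
## References
* [Jacobowitz1962] R. Jacobowitz, *Hermitian forms over local fields*, Amer. J. Math. 84 (1962): §4 (duals, gluing).
* [Kottwitz1986BaseChangeUnits] R. E. Kottwitz, *Base change for unit elements of Hecke algebras*, Compositio Math. 60 (1986): §1 pp. 240–241, §3.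
* [Rogawski1990] J. D. Rogawski, *Automorphic Representations of Unitary Groups in Three Variables*, Ann. of Math. Stud. 123 (1990): §4.9 Prop. 4.9.1 (b) p. 55, §12.2.
* [Serre1979] J.-P. Serre, *Local Fields*, GTM 67 (1979): Ch. III §6 Prop. 12, Ch. V §3 Cor. 3, Ch. XV §2; [LanglandsShelstad1987] R. P. Langlands, D. Shelstad, Math. Ann. 278 (1987): §1–§3.
-/

set_option autoImplicit false

noncomputable section

namespace Summit.HodgeConjecture.HodgeConjecture.Cruxes.H413.F0P3cDyRamUpperRayVertexReads

open scoped Valued WithZero Matrix MatrixGroups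
open WithZero
open Literature.NumberTheory.Automorphic Literature.NumberTheory.Automorphic.HermitianLattice Literature.NumberTheory.Automorphic.UnitaryLatticeTree
open Literature.NumberTheory.Automorphic.UnitaryThreeFourFrame (IsRamifiedQuadraticDatum normSign)
open Literature.NumberTheory.Rogawski1990
open Literature.NumberTheory.LocalFields (isAdicComplete_valuedInteger_of_completeSpace)
open Summit.HodgeConjecture.HodgeConjecture.Cruxes.H413.F0P3cDyRamFourFramePieces
open Summit.HodgeConjecture.HodgeConjecture.Cruxes.H413.F0P3cDyRamFourFrameCensusDefs (LatticeInLevel)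
open Summit.HodgeConjecture.HodgeConjecture.Cruxes.H413.F0P3cDyRamToricCensusDefs
open Summit.HodgeConjecture.HodgeConjecture.Cruxes.H413.F0P3cDyRamDiagonalCellLetter (inv_add_map_inv_eq_map_pairing)
open Summit.HodgeConjecture.HodgeConjecture.Cruxes.H413.F0P3cDyRamRayScalarNearlyFixed (exists_fixed_unit_valueSet_endoGL_sub_one_glued_eq_smul_xPlus)
open Summit.HodgeConjecture.HodgeConjecture.Cruxes.H413.F0P3cDyRamSmulXPlusLabel (labelPlus_smul_xPlus_iff_exists_norm)
open Summit.HodgeConjecture.HodgeConjecture.Cruxes.H413.F0P3cDyRamLabelShellFlipCardTwo (v_refSkew_eq)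
open Summit.HodgeConjecture.HodgeConjecture.Cruxes.H413.F0P3cDyRamUpperLineRayLetters (exactLevel_iff_v_rayScalar_eq latticeInLevel_iff_v_rayScalar_le)
open Summit.HodgeConjecture.HodgeConjecture.Cruxes.H413.F0P3cDyRamUpperLineCellCentre (trace_div_cellScalar_eq_root)
open Summit.HodgeConjecture.HodgeConjecture.Cruxes.H413.F0P3cDyRamRootRegimeAffineLabel (normSign_eq_mul_of_rootRegime v_mul_eq_of_v_sub_lt v_centre_iff_of_lt v_centre_le_iff_of_le)

variable {E M : Type} [Field E] [Valued E ℤᵐ⁰] [Field M] [Valued M ℤᵐ⁰] {ρ Θ : M →+* M} {α : M}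

/-! ## §1 The ray scalar in root form on `E`, and its size on the sphere ∕ in the ball -/

omit [Valued E ℤᵐ⁰] [Valued M ℤᵐ⁰] in
/-- **THE RAY SCALAR IN ROOT FORM, ON `E`**: `jE e₀ = Tr_ρ(μ∕D₀)`, the glue letter `D₀⁻¹ + ρD₀⁻¹ = jE pw` (`pw ≠ 0`), the coordinate `D₀⁻¹(jE pw)⁻¹ = κ₀ + jE V·ξ₀`, the
centre `jE W·ξ₀ = κ_c − κ₀` and the slope `jE B = (μ − ρμ)ξ₀` ⟹ `e₀ = pw·B·(V − W)` (★ F3 through the injectivity of `jE`). [cite: Jacobowitz1962, §4] [cite: Rogawski1990, §4.9 Prop. 4.9.1 (b) p. 55] -/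
theorem rayScalar_eq_root (jE : E →+* M) (hρj : ∀ c, ρ (jE c) = jE c) (hρρ : ∀ x, ρ (ρ x) = x)
    {D₀ μ κ₀ ξ₀ : M} {pw V W B e₀ : E} (hTr : D₀⁻¹ + ρ D₀⁻¹ = jE pw) (hpw : pw ≠ 0)
    (hκ : D₀⁻¹ * (jE pw)⁻¹ = κ₀ + jE V * ξ₀) (hμ : ρ μ ≠ μ) (hW : jE W * ξ₀ = ρ μ / (ρ μ - μ) - κ₀) (hB : jE B = (μ - ρ μ) * ξ₀)
    (he₀ : jE e₀ = μ / D₀ + ρ (μ / D₀)) :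
    e₀ = pw * B * (V - W) := by
  apply jE.injective
  rw [he₀, trace_div_cellScalar_eq_root jE hρj hρρ hTr hpw hκ hμ hW, map_mul, map_mul, hB]

omit [Valued M ℤᵐ⁰] [Field M] in
/-- **THE SIZE OF THE RAY SCALAR IS READ ON THE SPHERE**: `e₀ = pw·B·(V − W)`, `|pw·P| = 1`, `P ≠ 0`, `|t₊| = |ϖ|^{ℓ₀}`, `t₊ ≠ 0`, `θ = B∕(P·t₊)` with `|θ − γ₁| < |γ₁|` and
`|γ₁(W − W₁)| < 1` ⟹ (`|e₀| = |ϖ|^{ℓ₀} ↔ |γ₁(V − W₁)| = 1`). [cite: Serre1979, Ch. XV §2] [cite: Rogawski1990, §4.9 Prop. 4.9.1 (b) p. 55] -/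
theorem v_rayScalar_eq_iff_sphere {ϖ pw B V W P tp γ₁ W₁ e₀ : E} {ℓ₀ : ℕ} (he : e₀ = pw * B * (V - W))
    (hpwP : Valued.v (pw * P) = 1) (hP0 : P ≠ 0) (htp : Valued.v tp = Valued.v ϖ ^ ℓ₀) (htp0 : tp ≠ 0)
    (hθ : Valued.v (B / (P * tp) - γ₁) < Valued.v γ₁) (hWW : Valued.v (γ₁ * (W - W₁)) < 1) :
    Valued.v e₀ = Valued.v ϖ ^ ℓ₀ ↔ Valued.v (γ₁ * (V - W₁)) = 1 := by
  have hvtp0 : Valued.v tp ≠ 0 := (Valuation.ne_zero_iff _).2 htp0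
  have hfac : e₀ = (pw * P) * (B / (P * tp) * (V - W)) * tp := by rw [he]; field_simp
  rw [← v_centre_iff_of_lt hWW V, ← v_mul_eq_of_v_sub_lt hθ (V - W), hfac, Valuation.map_mul, Valuation.map_mul, hpwP, one_mul, ← htp]
  constructor
  · intro h; exact mul_right_cancel₀ hvtp0 (by rw [h, one_mul])
  · intro h; rw [h, one_mul]

omit [Valued M ℤᵐ⁰] [Field M] in
/-- **… AND IN THE BALL**: same letters with `|γ₁(W − W₁)|·|t₊| ≤ 1` ⟹ (`|e₀| ≤ 1 ↔ |γ₁(V − W₁)|·|t₊| ≤ 1`) — the DEPTH DIGIT of the level-`0` token. [cite: Serre1979, Ch. XV §2] -/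
theorem v_rayScalar_le_iff_ball {pw B V W P tp γ₁ W₁ e₀ : E} (he : e₀ = pw * B * (V - W))
    (hpwP : Valued.v (pw * P) = 1) (hP0 : P ≠ 0) (htp0 : tp ≠ 0)
    (hθ : Valued.v (B / (P * tp) - γ₁) < Valued.v γ₁) (hWW : Valued.v (γ₁ * (W - W₁)) * Valued.v tp ≤ 1) :
    Valued.v e₀ ≤ 1 ↔ Valued.v (γ₁ * (V - W₁)) * Valued.v tp ≤ 1 := by
  have hfac : e₀ = (pw * P) * (B / (P * tp) * (V - W)) * tp := by rw [he]; field_simp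
  rw [hfac, Valuation.map_mul, Valuation.map_mul, hpwP, one_mul, v_mul_eq_of_v_sub_lt hθ (V - W)]
  have e₁ : γ₁ * (V - W₁) = γ₁ * (V - W) + γ₁ * (W - W₁) := by ring
  have e₂ : γ₁ * (V - W) = γ₁ * (V - W₁) - γ₁ * (W - W₁) := by ring
  constructor
  · intro h
    rw [e₁, ← Valuation.map_mul, add_mul, ]
    refine (Valuation.map_add _ _ _).trans (max_le ?_ ?_)
    · rw [Valuation.map_mul]; exact h
    · rw [Valuation.map_mul]; exact hWW
  · intro h
    rw [e₂, ← Valuation.map_mul, sub_mul]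
    refine (Valuation.map_sub _ _ _).trans (max_le ?_ ?_)
    · rw [Valuation.map_mul]; exact h
    · rw [Valuation.map_mul]; exact hWW

/-! ## §2 HEAD 1 — the exact level of a glued vertex is the sphere digit of its coordinate -/

/-- **HEAD 1 — «EXACT LEVEL `ℓ₀` = THE SPHERE DIGIT».**  ★ p864080's glued-vertex frame (`hρρ hvρ hΘΘ hΘρ hvΘ hϖ jE hjv hρϖ φ hφs hφi hφγ hΘh hb hpr hB hg₀ hg₀1 hprg hBΛ hc hcc hx₀ hY0 hΛx hw₀Y u ℓ₀` +
the cell-constant letters at level `ℓ₀ + 1`: `hul hlam1 hlamρ hμl`) + the form letter `hform` (`h ≠ 0`) for the glue letter, the reference pair and the coordinate `V` (`hκ`), the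
centre `W` (`hW`), the slope `B` (`hBE`), `P ≠ 0` with `|pw·P| = 1`, `|t₊| = |ϖ|^{ℓ₀}` (`t₊ := (ϖ − σϖ)((ϖσϖ)^{(d−d%2)∕2})⁻¹`, `ℓ₀ = d % 2`), the SLOPE and ROOT letters (strict form).
THEN `(LatticeInLevel ϖ ℓ₀ (Γ − 1) L ∧ ¬ LatticeInLevel ϖ (ℓ₀ + 1) (Γ − 1) L) ↔ |γ₁(V − W₁)| = 1`. [cite: Kottwitz1986BaseChangeUnits, §3] [cite: Serre1979, Ch. III §6 Prop. 12] [cite: Jacobowitz1962, §4] -/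
theorem exactLevel_iff_sphere (hρρ : ∀ x, ρ (ρ x) = x) (hvρ : ∀ x, Valued.v (ρ x) = Valued.v x) (hΘΘ : ∀ x, Θ (Θ x) = x)
    (hΘρ : ∀ x, Θ (ρ x) = ρ (Θ x)) (hvΘ : ∀ x, Valued.v (Θ x) = Valued.v x) {σ : E →+* E} (hvσ : ∀ a, Valued.v (σ a) = Valued.v a)
    {ϖ : E} (hϖ : Valued.v ϖ = exp (-1 : ℤ)) {d : ℕ} (hd : Valued.v (ϖ - σ ϖ) = Valued.v ϖ ^ d)
    (jE : E →+* M) (hjv : ∀ c, Valued.v (jE c) ≤ 1 ↔ Valued.v c ≤ 1) (hjfix : ∀ z, ρ z = z ↔ ∃ c, jE c = z)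
    (H₂ : Matrix (Fin 2) (Fin 2) E)
    (φ : (Fin 2 → E) →+ M) (hφs : ∀ (c : E) (x : Fin 2 → E), φ (c • x) = jE c * φ x) (hφi : Function.Injective φ)
    {γ₂ : GL (Fin 2) E} {lam h : M} (hφγ : ∀ x, φ ((γ₂ : Matrix (Fin 2) (Fin 2) E) *ᵥ x) = lam * φ x) (hΘh : Θ h = h) (hh : h ≠ 0)
    (hform : ∀ x y, jE (pairing σ H₂ x y) = h * Θ (φ x) * φ y + ρ (h * Θ (φ x) * φ y))
    {L : Submodule 𝒪[E] (Fin 3 → E)} {b : ℕ} (hb : ∀ a : E, (Pi.single 1 a : Fin 3 → E) ∈ L ↔ Valued.v a ≤ Valued.v ϖ ^ b)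
    (hpr : ∀ x ∈ L, Valued.v (x 1) * Valued.v ϖ ^ b ≤ 1)
    {B₂ : Submodule 𝒪[E] (Fin 2 → E)} {w₀ : Fin 2 → E} {g₀ : Fin 3 → E}
    (hB : B₂.map ((Matrix.toLin' (!![1, 0; 0, 0; 0, 1] : Matrix (Fin 3) (Fin 2) E)).restrictScalars 𝒪[E]) =
      L ⊓ LinearMap.ker ((LinearMap.proj (1 : Fin 3) : (Fin 3 → E) →ₗ[E] E).restrictScalars 𝒪[E]))
    (hg₀ : g₀ ∈ L) (hg₀1 : Valued.v (g₀ 1) * Valued.v ϖ ^ b = 1) (hprg : g₀ - Pi.single 1 (g₀ 1) = ![w₀ 0, 0, w₀ 1])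
    {Λ : AddSubgroup M} (hBΛ : B₂.toAddSubgroup.map φ = Λ) {j : ℕ} (hcc : jE ϖ ^ j * (α - ρ α) ≠ 0) {x₀ : M} (hx₀ : x₀ ≠ 0)
    (hY0 : dualGen ρ Θ α (jE ϖ ^ j) h x₀ ≠ 0) (hΛx : ∀ x, x ∈ Λ ↔ ∃ z, IsOrd ρ α (jE ϖ ^ j) z ∧ x = x₀ * z)
    (hw₀Y : φ w₀ = (dualGen ρ Θ α (jE ϖ ^ j) h x₀)⁻¹ * x₀)
    (u : GL (Fin 1) E)
    (hul : Valued.v ((u : Matrix (Fin 1) (Fin 1) E) 0 0 - 1) ≤ Valued.v (ϖ ^ (d % 2 + 1)))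
    (hlam1 : Valued.v (lam - 1) ≤ Valued.v (jE ϖ) ^ (d % 2 + 1))
    (hlamρ : Valued.v (lam - ρ lam) ≤ Valued.v (jE ϖ ^ j * (α - ρ α)) * Valued.v (jE ϖ) ^ (d % 2 + 1))
    (hμl : Valued.v (lam - jE ((u : Matrix (Fin 1) (Fin 1) E) 0 0)) ≤ Valued.v (jE ϖ ^ (d % 2 + 1) * dualGen ρ Θ α (jE ϖ ^ j) h x₀))
    (hμρ : ρ (lam - jE ((u : Matrix (Fin 1) (Fin 1) E) 0 0)) ≠ lam - jE ((u : Matrix (Fin 1) (Fin 1) E) 0 0))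
    -- the root-regime tail: coordinate, centre, slope, `P`, the SLOPE and ROOT letters
    {κ₀ ξ₀ : M} {V W BE P γ₁ W₁ : E}
    (hκ : (jE ϖ ^ j * (α - ρ α) * Θ (dualGen ρ Θ α (jE ϖ ^ j) h x₀))⁻¹ * (jE (pairing σ H₂ w₀ w₀))⁻¹ = κ₀ + jE V * ξ₀)
    (hW : jE W * ξ₀ = ρ (lam - jE ((u : Matrix (Fin 1) (Fin 1) E) 0 0)) / (ρ (lam - jE ((u : Matrix (Fin 1) (Fin 1) E) 0 0)) - (lam - jE ((u : Matrix (Fin 1) (Fin 1) E) 0 0))) - κ₀)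
    (hBE : jE BE = ((lam - jE ((u : Matrix (Fin 1) (Fin 1) E) 0 0)) - ρ (lam - jE ((u : Matrix (Fin 1) (Fin 1) E) 0 0))) * ξ₀)
    (hP0 : P ≠ 0) (hpwP : Valued.v (pairing σ H₂ w₀ w₀ * P) = 1)
    (hθ : Valued.v (BE / (P * ((ϖ - σ ϖ) * ((ϖ * σ ϖ) ^ ((d - d % 2) / 2))⁻¹)) - γ₁) < Valued.v γ₁) (hWW : Valued.v (γ₁ * (W - W₁)) < 1) :
    (LatticeInLevel ϖ (d % 2) ((((endoGL (γ₂, u) : GL (Fin 3) E) : Matrix (Fin 3) (Fin 3) E) - 1)) L ∧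
        ¬ LatticeInLevel ϖ (d % 2 + 1) ((((endoGL (γ₂, u) : GL (Fin 3) E) : Matrix (Fin 3) (Fin 3) E) - 1)) L) ↔
      Valued.v (γ₁ * (V - W₁)) = 1 := by
  have hvϖ0 : Valued.v ϖ ≠ 0 := by rw [hϖ]; exact exp_ne_zero
  have hϖ0 : ϖ ≠ 0 := fun h0 => hvϖ0 (by rw [h0, map_zero])
  have hρj : ∀ c : E, ρ (jE c) = jE c := fun c => (hjfix _).2 ⟨c, rfl⟩
  have hρϖ : ρ (jE ϖ) = jE ϖ := hρj ϖ
  have hc : ρ (jE ϖ ^ j) = jE ϖ ^ j := by rw [map_pow, hρϖ]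
  -- the ray scalar exists on `E` (it is `ρ`-fixed)
  set D₀ : M := jE ϖ ^ j * (α - ρ α) * Θ (dualGen ρ Θ α (jE ϖ ^ j) h x₀) with hD₀
  obtain ⟨e₀, he₀⟩ : ∃ e₀ : E, jE e₀ = (lam - jE ((u : Matrix (Fin 1) (Fin 1) E) 0 0)) / D₀ + ρ ((lam - jE ((u : Matrix (Fin 1) (Fin 1) E) 0 0)) / D₀) :=
    (hjfix _).1 (by rw [map_add, hρρ, add_comm])
  rw [exactLevel_iff_v_rayScalar_eq hρρ hvρ hΘΘ hΘρ hvΘ hϖ jE hjv hρϖ φ hφs hφi hφγ hΘh hb hpr hB hg₀ hg₀1 hprg hBΛ hc hcc hx₀ hY0 hΛx hw₀Y u (d % 2)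
    hul hlam1 hlamρ hμl he₀]
  -- `e₀ = pw·B·(V − W)` and the size on the sphere
  have hTr : D₀⁻¹ + ρ D₀⁻¹ = jE (pairing σ H₂ w₀ w₀) := inv_add_map_inv_eq_map_pairing σ H₂ jE hΘΘ φ hh hform hcc hx₀ hw₀Y
  have hpw0 : pairing σ H₂ w₀ w₀ ≠ 0 := fun h0 => by rw [h0, zero_mul, map_zero] at hpwP; exact zero_ne_one hpwP
  have he : e₀ = pairing σ H₂ w₀ w₀ * BE * (V - W) := rayScalar_eq_root jE hρj hρρ hTr hpw0 hκ hμρ hW hBE he₀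
  have htp : Valued.v ((ϖ - σ ϖ) * ((ϖ * σ ϖ) ^ ((d - d % 2) / 2))⁻¹) = Valued.v ϖ ^ (d % 2) := v_refSkew_eq hvσ hϖ hd
  have htp0 : (ϖ - σ ϖ) * ((ϖ * σ ϖ) ^ ((d - d % 2) / 2))⁻¹ ≠ 0 := fun h0 => by rw [h0, map_zero] at htp; exact pow_ne_zero _ hvϖ0 htp.symm
  exact v_rayScalar_eq_iff_sphere he hpwP hP0 htp htp0 hθ hWW

/-- **HEAD 1-bis — «THE DEPTH TOKEN IS THE BALL DIGIT».**  One-field letters (`hρρ hΘΘ hΘρ hvΘ hΘh`), `|ϖ| = exp(−1)`, `|ϖ − σϖ| = |ϖ|^d`, `jE`-letters, the form letter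
`hform` (`h ≠ 0`) for the glue letter, `cc(α − ρα) ≠ 0` (`cc = jEϖ^j`), `x₀ ≠ 0`, `Y ≠ 0`, `φ w₀ = Y⁻¹x₀`, the size `|μ| ≤ |Y|`, `ρμ ≠ μ`, and the root-regime tail with the ROOT
letter in ball form `|γ₁(W − W₁)|·|t₊| ≤ 1`.  THEN `IsOrd ρ α cc (μ ∕ Y) ↔ |γ₁(V − W₁)|·|t₊| ≤ 1` — the depth clause of ★ DEFS `levelSetDep` (★ DEFS `mem_levelSetDep_iff_isOrd_div`)
read as a DIGIT of the coordinate. [cite: Kottwitz1986BaseChangeUnits, §1 pp. 240–241; §3] [cite: Serre1979, Ch. III §6 Prop. 12] [cite: Jacobowitz1962, §4] -/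
theorem isOrd_div_iff_ball (hρρ : ∀ x, ρ (ρ x) = x) (hΘΘ : ∀ x, Θ (Θ x) = x) (hΘρ : ∀ x, Θ (ρ x) = ρ (Θ x)) (hvΘ : ∀ x, Valued.v (Θ x) = Valued.v x)
    {σ : E →+* E} (hvσ : ∀ a, Valued.v (σ a) = Valued.v a) {ϖ : E} (hϖ : Valued.v ϖ = exp (-1 : ℤ)) {d : ℕ} (hd : Valued.v (ϖ - σ ϖ) = Valued.v ϖ ^ d)
    (jE : E →+* M) (hjv : ∀ c, Valued.v (jE c) ≤ 1 ↔ Valued.v c ≤ 1) (hjfix : ∀ z, ρ z = z ↔ ∃ c, jE c = z)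
    (H₂ : Matrix (Fin 2) (Fin 2) E) (φ : (Fin 2 → E) →+ M) {hM : M} (hΘh : Θ hM = hM) (hh : hM ≠ 0)
    (hform : ∀ x y, jE (pairing σ H₂ x y) = hM * Θ (φ x) * φ y + ρ (hM * Θ (φ x) * φ y))
    {j : ℕ} (hcc : jE ϖ ^ j * (α - ρ α) ≠ 0) {x₀ : M} (hx₀ : x₀ ≠ 0) (hY0 : dualGen ρ Θ α (jE ϖ ^ j) hM x₀ ≠ 0)
    {w₀ : Fin 2 → E} (hw₀Y : φ w₀ = (dualGen ρ Θ α (jE ϖ ^ j) hM x₀)⁻¹ * x₀) {μ : M} (hμρ : ρ μ ≠ μ)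
    (hμY : Valued.v μ ≤ Valued.v (dualGen ρ Θ α (jE ϖ ^ j) hM x₀))
    {κ₀ ξ₀ : M} {V W BE P γ₁ W₁ : E}
    (hκ : (jE ϖ ^ j * (α - ρ α) * Θ (dualGen ρ Θ α (jE ϖ ^ j) hM x₀))⁻¹ * (jE (pairing σ H₂ w₀ w₀))⁻¹ = κ₀ + jE V * ξ₀)
    (hW : jE W * ξ₀ = ρ μ / (ρ μ - μ) - κ₀) (hBE : jE BE = (μ - ρ μ) * ξ₀)
    (hP0 : P ≠ 0) (hpwP : Valued.v (pairing σ H₂ w₀ w₀ * P) = 1)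
    (hθ : Valued.v (BE / (P * ((ϖ - σ ϖ) * ((ϖ * σ ϖ) ^ ((d - d % 2) / 2))⁻¹)) - γ₁) < Valued.v γ₁)
    (hWWt : Valued.v (γ₁ * (W - W₁)) * Valued.v ((ϖ - σ ϖ) * ((ϖ * σ ϖ) ^ ((d - d % 2) / 2))⁻¹) ≤ 1) :
    IsOrd ρ α (jE ϖ ^ j) (μ / dualGen ρ Θ α (jE ϖ ^ j) hM x₀) ↔
      Valued.v (γ₁ * (V - W₁)) * Valued.v ((ϖ - σ ϖ) * ((ϖ * σ ϖ) ^ ((d - d % 2) / 2))⁻¹) ≤ 1 := by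
  have hvϖ0 : Valued.v ϖ ≠ 0 := by rw [hϖ]; exact exp_ne_zero
  have hϖ0 : ϖ ≠ 0 := fun h0 => hvϖ0 (by rw [h0, map_zero])
  have hjϖ0 : jE ϖ ≠ 0 := (map_ne_zero jE).2 hϖ0
  have hρj : ∀ c : E, ρ (jE c) = jE c := fun c => (hjfix _).2 ⟨c, rfl⟩
  have hρϖ : ρ (jE ϖ) = jE ϖ := hρj ϖ
  have hc : ρ (jE ϖ ^ j) = jE ϖ ^ j := by rw [map_pow, hρϖ]
  set D₀ : M := jE ϖ ^ j * (α - ρ α) * Θ (dualGen ρ Θ α (jE ϖ ^ j) hM x₀) with hD₀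
  obtain ⟨e₀, he₀⟩ : ∃ e₀ : E, jE e₀ = μ / D₀ + ρ (μ / D₀) := (hjfix _).1 (by rw [map_add, hρρ, add_comm])
  have key := F0P3cDyRamUpperLineRayLetters.isOrd_div_pow_mul_iff (α := α) hρρ hΘΘ hΘρ hvΘ hΘh hc hcc hρϖ hjϖ0 hY0 μ 0 he₀
  rw [pow_zero, one_mul, pow_zero] at key
  rw [key, and_iff_right hμY, hjv e₀]
  have hTr : D₀⁻¹ + ρ D₀⁻¹ = jE (pairing σ H₂ w₀ w₀) := inv_add_map_inv_eq_map_pairing σ H₂ jE hΘΘ φ hh hform hcc hx₀ hw₀Y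
  have hpw0 : pairing σ H₂ w₀ w₀ ≠ 0 := fun h0 => by rw [h0, zero_mul, map_zero] at hpwP; exact zero_ne_one hpwP
  have he : e₀ = pairing σ H₂ w₀ w₀ * BE * (V - W) := rayScalar_eq_root jE hρj hρρ hTr hpw0 hκ hμρ hW hBE he₀
  have htp : Valued.v ((ϖ - σ ϖ) * ((ϖ * σ ϖ) ^ ((d - d % 2) / 2))⁻¹) = Valued.v ϖ ^ (d % 2) := v_refSkew_eq hvσ hϖ hd
  have htp0 : (ϖ - σ ϖ) * ((ϖ * σ ϖ) ^ ((d - d % 2) / 2))⁻¹ ≠ 0 := fun h0 => by rw [h0, map_zero] at htp; exact pow_ne_zero _ hvϖ0 htp.symm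
  exact v_rayScalar_le_iff_ball he hpwP hP0 htp0 hθ hWWt

/-! ## §3 HEAD 2 — on the sphere, the label is the sign -/

/-- **HEAD 2 — «ON THE SPHERE THE LABEL OF THE VERTEX IS THE SIGN `ω(pw·P)·ω(γ₁(V − W₁))`».**  ★ p863048's HEAD frame VERBATIM (`hD H₂ h jE hjv hjfix hρρ hvρ hα hα1 hintρ hΘΘ hΘρ hvΘ
hΘj φ hφs hφγ hhM hΘh hform hpr hint hB hg₀ hg₀1 hprg u hc hc0 hc1 hcc hx₀ hBΛ hΛx hw₀Y hYO hμ hμt hmm hΘlam hvlam huu hP hn hlamn hun hsk`, with `E` complete) WITHOUT `he₀ he₀v`,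
plus the root-regime tail (`hκ hW hBE hP0 hσP hpwP γ₁ W₁ hσγ hσW₁ hσV` and the SLOPE `|θ − γ₁| ≤ |γ₁|·|ϖ|^{2d−1}`, ROOT `|γ₁(W − W₁)| ≤ |ϖ|^{2d−1}` letters) and the SPHERE
`|γ₁(V − W₁)| = 1`.  THEN `VS_{m⋆}(Γ − 1 | L) = valueSetMod σ ϖ m⋆ (X₊) ↔ normSign σ (pw·P)·normSign σ (γ₁(V − W₁)) = 1` (`pw = ⟨w₀, w₀⟩`).
[cite: Rogawski1990, §4.9 Prop. 4.9.1 (b) p. 55] [cite: Kottwitz1986BaseChangeUnits, §1 pp. 240–241] [cite: Jacobowitz1962, §4] [cite: Serre1979, Ch. V §3 Cor. 3; Ch. XV §2] [cite: LanglandsShelstad1987, §1–§3] -/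
theorem valueSet_eq_xPlus_iff_sphereSign [CompleteSpace E] [Finite 𝓀[E]] {σ : E →+* E} {ϖ : E} {d t : ℕ} (hD : IsRamifiedQuadraticDatum σ ϖ d t)
    (H₂ : Matrix (Fin 2) (Fin 2) E) (hW : E)
    (jE : E →+* M) (hjv : ∀ c, Valued.v (jE c) ≤ 1 ↔ Valued.v c ≤ 1) (hjfix : ∀ z, ρ z = z ↔ ∃ c, jE c = z)
    (hρρ : ∀ x, ρ (ρ x) = x) (hvρ : ∀ x, Valued.v (ρ x) = Valued.v x) (hα : ρ α ≠ α) (hα1 : Valued.v α ≤ 1)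
    (hintρ : ∀ z : M, Valued.v z ≤ 1 → Valued.v ((z - ρ z) / (α - ρ α)) ≤ 1)
    (hΘΘ : ∀ x, Θ (Θ x) = x) (hΘρ : ∀ x, Θ (ρ x) = ρ (Θ x)) (hvΘ : ∀ x, Valued.v (Θ x) = Valued.v x) (hΘj : ∀ c, Θ (jE c) = jE (σ c))
    (φ : (Fin 2 → E) →+ M) (hφs : ∀ (c : E) (x : Fin 2 → E), φ (c • x) = jE c * φ x)
    {γ₂ : GL (Fin 2) E} {lam hM : M} (hφγ : ∀ x, φ ((γ₂ : Matrix (Fin 2) (Fin 2) E) *ᵥ x) = lam * φ x) (hhM : hM ≠ 0) (hΘh : Θ hM = hM)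
    (hform : ∀ x y, jE (pairing σ H₂ x y) = hM * Θ (φ x) * φ y + ρ (hM * Θ (φ x) * φ y))
    {L : Submodule 𝒪[E] (Fin 3 → E)} {b : ℕ} (hpr : ∀ x ∈ L, Valued.v (x 1) * Valued.v ϖ ^ b ≤ 1)
    (hint : ∀ y ∈ L, Valued.v (pairing σ (!![H₂ 0 0, 0, H₂ 0 1; 0, hW, 0; H₂ 1 0, 0, H₂ 1 1] : Matrix (Fin 3) (Fin 3) E) y y) ≤ 1)
    {B₂ : Submodule 𝒪[E] (Fin 2 → E)} {w₀ : Fin 2 → E} {g₀ : Fin 3 → E}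
    (hB : B₂.map ((Matrix.toLin' (!![1, 0; 0, 0; 0, 1] : Matrix (Fin 3) (Fin 2) E)).restrictScalars 𝒪[E]) =
      L ⊓ LinearMap.ker ((LinearMap.proj (1 : Fin 3) : (Fin 3 → E) →ₗ[E] E).restrictScalars 𝒪[E]))
    (hg₀ : g₀ ∈ L) (hg₀1 : Valued.v (g₀ 1) * Valued.v ϖ ^ b = 1) (hprg : g₀ - Pi.single 1 (g₀ 1) = ![w₀ 0, 0, w₀ 1])
    (u : GL (Fin 1) E)
    {cc x₀ : M} (hc : ρ cc = cc) (hc0 : cc ≠ 0) (hc1 : Valued.v cc ≤ 1) (hcc : cc * (α - ρ α) ≠ 0) (hx₀ : x₀ ≠ 0)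
    {Λ : AddSubgroup M} (hBΛ : B₂.toAddSubgroup.map φ = Λ)
    (hΛx : ∀ x, x ∈ Λ ↔ ∃ ζ, IsOrd ρ α cc ζ ∧ x = x₀ * ζ) (hw₀Y : φ w₀ = (dualGen ρ Θ α cc hM x₀)⁻¹ * x₀)
    -- the ray-domination letters (★ p861653) at the modulus `m*`
    (hYO : IsOrd ρ α cc (dualGen ρ Θ α cc hM x₀))
    {μt : M} {m' : ℕ} (hμ : lam - jE ((u : Matrix (Fin 1) (Fin 1) E) 0 0) = jE (ϖ ^ m') * μt) (hμt : IsOrd ρ α cc μt) (hmm : mstarOfRecord d ≤ m')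
    -- the line-model structure, the population token, the three deep tokens
    (hΘlam : Θ lam * lam = 1) (hvlam : Valued.v lam = 1)
    (huu : ((u : Matrix (Fin 1) (Fin 1) E) 0 0) * σ ((u : Matrix (Fin 1) (Fin 1) E) 0 0) = 1)
    (hP : IsOrd ρ α cc ((lam - jE ((u : Matrix (Fin 1) (Fin 1) E) 0 0)) / dualGen ρ Θ α cc hM x₀))
    {n : ℕ} (hn : 3 * d - 2 + d % 2 ≤ n)
    (hlamn : Valued.v (lam - 1) ≤ Valued.v (jE ϖ) ^ n) (hun : Valued.v ((u : Matrix (Fin 1) (Fin 1) E) 0 0 - 1) ≤ Valued.v ϖ ^ n)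
    (hsk : Valued.v ((lam - jE ((u : Matrix (Fin 1) (Fin 1) E) 0 0)) / dualGen ρ Θ α cc hM x₀) * Valued.v (lam - ρ lam) ≤
      Valued.v (jE ϖ) ^ n * Valued.v (cc * (α - ρ α)))
    -- the root-regime tail
    (hμρ : ρ (lam - jE ((u : Matrix (Fin 1) (Fin 1) E) 0 0)) ≠ lam - jE ((u : Matrix (Fin 1) (Fin 1) E) 0 0))
    {κ₀ ξ₀ : M} {V W BE P γ₁ W₁ : E} (hσV : σ V = V)
    (hκ : (cc * (α - ρ α) * Θ (dualGen ρ Θ α cc hM x₀))⁻¹ * (jE (pairing σ H₂ w₀ w₀))⁻¹ = κ₀ + jE V * ξ₀)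
    (hWc : jE W * ξ₀ = ρ (lam - jE ((u : Matrix (Fin 1) (Fin 1) E) 0 0)) / (ρ (lam - jE ((u : Matrix (Fin 1) (Fin 1) E) 0 0)) - (lam - jE ((u : Matrix (Fin 1) (Fin 1) E) 0 0))) - κ₀)
    (hBE : jE BE = ((lam - jE ((u : Matrix (Fin 1) (Fin 1) E) 0 0)) - ρ (lam - jE ((u : Matrix (Fin 1) (Fin 1) E) 0 0))) * ξ₀)
    (hP0 : P ≠ 0) (hσP : σ P = P) (hσpw : σ (pairing σ H₂ w₀ w₀) = pairing σ H₂ w₀ w₀) (hpwP : Valued.v (pairing σ H₂ w₀ w₀ * P) = 1)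
    (hσγ : σ γ₁ = γ₁) (hσW₁ : σ W₁ = W₁)
    (hθ : Valued.v (BE / (P * ((ϖ - σ ϖ) * ((ϖ * σ ϖ) ^ ((d - d % 2) / 2))⁻¹)) - γ₁) ≤ Valued.v γ₁ * Valued.v ϖ ^ (2 * d - 1))
    (hWW : Valued.v (γ₁ * (W - W₁)) ≤ Valued.v ϖ ^ (2 * d - 1))
    (hsph : Valued.v (γ₁ * (V - W₁)) = 1) :
    ({z : E | ∃ y ∈ L, Valued.v ((ϖ ^ mstarOfRecord d)⁻¹ * (z - pairing σ (!![H₂ 0 0, 0, H₂ 0 1; 0, hW, 0; H₂ 1 0, 0, H₂ 1 1] : Matrix (Fin 3) (Fin 3) E) y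
          ((((endoGL (γ₂, u) : GL (Fin 3) E) : Matrix (Fin 3) (Fin 3) E) - 1) *ᵥ y))) ≤ 1} =
        valueSetMod σ ϖ (mstarOfRecord d) (xPlus σ ϖ d)) ↔
      normSign σ (pairing σ H₂ w₀ w₀ * P) * normSign σ (γ₁ * (V - W₁)) = 1 := by
  classical
  obtain ⟨hσσ, hvσ, hϖ, -, hd, hd1, -⟩ := id hD
  haveI := isAdicComplete_valuedInteger_of_completeSpace (K := E) hϖ
  have hvϖ0 : Valued.v ϖ ≠ 0 := by rw [hϖ]; exact exp_ne_zero
  have hϖ0 : ϖ ≠ 0 := fun h0 => by rw [h0, map_zero] at hvϖ0; exact hvϖ0 rfl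
  have hϖlt : Valued.v ϖ < 1 := by rw [hϖ, ← exp_zero, exp_lt_exp]; norm_num
  have hρj : ∀ c : E, ρ (jE c) = jE c := fun c => (hjfix _).2 ⟨c, rfl⟩
  have hsmall : Valued.v ϖ ^ (2 * d - 1) < 1 := pow_lt_one₀ zero_le hϖlt (by omega)
  set D₀ : M := cc * (α - ρ α) * Θ (dualGen ρ Θ α cc hM x₀) with hD₀def
  set pw : E := pairing σ H₂ w₀ w₀ with hpwdef
  set tp : E := (ϖ - σ ϖ) * ((ϖ * σ ϖ) ^ ((d - d % 2) / 2))⁻¹ with htpdef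
  -- the glue letter and the ray scalar in root form
  have hTr : D₀⁻¹ + ρ D₀⁻¹ = jE pw := inv_add_map_inv_eq_map_pairing σ H₂ jE hΘΘ φ hhM hform hcc hx₀ hw₀Y
  have hpw0 : pw ≠ 0 := fun h0 => by rw [h0, zero_mul, Valuation.map_zero] at hpwP; exact zero_ne_one hpwP
  obtain ⟨e₀, he₀⟩ : ∃ e₀ : E, jE e₀ = (lam - jE ((u : Matrix (Fin 1) (Fin 1) E) 0 0)) / D₀ + ρ ((lam - jE ((u : Matrix (Fin 1) (Fin 1) E) 0 0)) / D₀) :=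
    (hjfix _).1 (by rw [map_add, hρρ, add_comm])
  have he : e₀ = pw * BE * (V - W) := rayScalar_eq_root jE hρj hρρ hTr hpw0 hκ hμρ hWc hBE he₀
  -- sizes: `|t₊| = |ϖ|^{ℓ₀}`, the strict forms of the two letters, `|e₀| = |ϖ|^{ℓ₀}` on the sphere
  have htp : Valued.v tp = Valued.v ϖ ^ (d % 2) := v_refSkew_eq hvσ hϖ hd
  have htp0 : tp ≠ 0 := fun h0 => by rw [h0, map_zero] at htp; exact pow_ne_zero _ hvϖ0 htp.symm
  have hγ0 : γ₁ ≠ 0 := fun h0 => by rw [h0, zero_mul, map_zero] at hsph; exact zero_ne_one hsph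
  have hγpos : (0 : ℤᵐ⁰) < Valued.v γ₁ := zero_lt_iff.2 ((Valuation.ne_zero_iff _).2 hγ0)
  have hθlt : Valued.v (BE / (P * tp) - γ₁) < Valued.v γ₁ :=
    hθ.trans_lt (by calc Valued.v γ₁ * Valued.v ϖ ^ (2 * d - 1) < Valued.v γ₁ * 1 := mul_lt_mul_of_pos_left hsmall hγpos
      _ = Valued.v γ₁ := mul_one _)
  have hWlt : Valued.v (γ₁ * (W - W₁)) < 1 := hWW.trans_lt hsmall
  have he₀v : Valued.v e₀ = Valued.v ϖ ^ (d % 2) := (v_rayScalar_eq_iff_sphere he hpwP hP0 htp htp0 hθlt hWlt).2 hsph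
  -- ★ p863048: the vertex is the fixed-unit ray `e′ • X₊`
  obtain ⟨e', he'σ, he'1, hclose, hVS⟩ := exists_fixed_unit_valueSet_endoGL_sub_one_glued_eq_smul_xPlus hD H₂ hW jE hjv hjfix hρρ hvρ hα hα1 hintρ hΘΘ hΘρ hvΘ hΘj φ hφs
    hφγ hhM hΘh hform hpr hint hB hg₀ hg₀1 hprg u hc hc0 hc1 hcc hx₀ hBΛ hΛx hw₀Y hYO hμ hμt hmm hΘlam hvlam huu hP he₀ he₀v hn hlamn hun hsk
  rw [hVS]
  have hbit : valueSetMod σ ϖ (mstarOfRecord d) (e' • xPlus σ ϖ d) = valueSetMod σ ϖ (mstarOfRecord d) (xPlus σ ϖ d) ↔ ∃ z : E, z * σ z = e' :=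
    labelPlus_smul_xPlus_iff_exists_norm hD he'σ he'1
  rw [hbit]
  -- the root-regime dictionary at `T := pw·P`, `θ := BE∕(P·t₊)`, `f := e′`
  have hσT : σ (pw * P) = pw * P := by rw [map_mul, hσpw, hσP]
  have hnear : Valued.v (pw * P * (BE / (P * tp) * (V - W)) - e') ≤ Valued.v ϖ ^ (2 * d - 1) := by
    have hm : mstarOfRecord d = d % 2 + (2 * d - 1) := by rw [show mstarOfRecord d = d % 2 + 2 * d - 1 from rfl]; omega
    have e1 : pw * P * (BE / (P * tp) * (V - W)) - e' = tp⁻¹ * (e₀ - e' * tp) := by rw [he]; field_simp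
    have htppos : (0 : ℤᵐ⁰) < Valued.v tp := zero_lt_iff.2 ((Valuation.ne_zero_iff _).2 htp0)
    rw [e1, Valuation.map_mul, map_inv₀, htp, ← div_eq_inv_mul, div_le_iff₀ (by rw [← htp]; exact htppos), ← pow_add, add_comm, ← hm]
    exact hclose
  have hns := normSign_eq_mul_of_rootRegime hD hσγ hσW₁ hσT hpwP hσV he'σ hθ hWW hsph hnear
  constructor
  · intro hz
    have h1 : normSign σ e' = 1 := by rw [normSign, if_pos hz]
    rw [← h1, hns]
  · intro h1
    rw [← hns] at h1
    by_contra hz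
    rw [normSign, if_neg hz] at h1
    exact absurd h1 (by norm_num)

end Summit.HodgeConjecture.HodgeConjecture.Cruxes.H413.F0P3cDyRamUpperRayVertexReads

end
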